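import Mathlib
import HarnessLib
import Summits.NavierStokesRegularity.NavierStokesRegularity.Theorems.PoloidalWindowDoorLrcModEntireTwistingTHHelmholtzLiouville

/-!
# Item `LrcModEntire` (stmt-NavierStokesRegularity-20428) — T1 cell, step (I): STUB (L3) `stub_helmholtzOneSigned` BY NAME

Cell ns-regularity-ideate, seat ns-k2-port-2 g4 (`--supports stmt-NavierStokesRegularity-20428 --as helper`).  The LEAD's (ns-poloidal-K2-p3 g13) crux workfile
`Cruxes/LrcModEntire/T1StepI.lean` proves cell T1° of the (TH) column from TWO stubs; the first, `stub_helmholtzOneSigned` («one-signed entire solutions of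
`Δψ + κψ = 0`, `κ > 0`, on `ℝ³` vanish»), is here a THEOREM with the stub's signature VERBATIM — a one-line specialisation (`E = ℝ³`, binder order) of
`…TwistingTHHelmholtzLiouville.helmholtzLiouville_of_nonpos` (p699136: positivity test function `((R² − ‖x − x₀‖²)₊)³` + Green's identity).
FILL for the workfile: `exact Summit.NavierStokesRegularity.NavierStokesRegularity.Theorems.PoloidalWindowDoorLrcModEntireTwistingTHT1HelmholtzOneSigned.helmholtzOneSigned`.

WHAT THIS IS NOT: not a claim about Navier–Stokes regularity; the other stub of the cell (`stub_flatPlane_badData`, the z-jet analysis) and the cell's standing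
hypotheses ⟨27893⟩, T2b are untouched (bears_on LADDER-NS N0, item 20428 / crux 19708; both OPEN).
-/

noncomputable section

-- the summit and its single sub-problem share the name (CONVENTIONS §1), as in every Theorems file
set_option linter.dupNamespace false

namespace Summit.NavierStokesRegularity.NavierStokesRegularity.Theorems.PoloidalWindowDoorLrcModEntireTwistingTHT1HelmholtzOneSigned

open Set Function Filter Topology
open scoped RealInnerProductSpace InnerProductSpace Laplacian
open Summit.NavierStokesRegularity.NavierStokesRegularity.Theorems.PoloidalWindowDoorLrcModEntireTwistingTHHelmholtzLiouville

/-- **(L3) `stub_helmholtzOneSigned` of `Cruxes/LrcModEntire/T1StepI.lean`, VERBATIM**: `ψ ∈ C²(ℝ³)`, `κ > 0`, `ψ ≤ 0`, `Δψ = −κψ` ⇒ `ψ ≡ 0`. -/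
theorem helmholtzOneSigned :
    ∀ (ψ : EuclideanSpace ℝ (Fin 3) → ℝ) (κ : ℝ), ContDiff ℝ 2 ψ → 0 < κ → (∀ x, ψ x ≤ 0) → (∀ x, (Δ ψ) x = -κ * ψ x) →
      ∀ x, ψ x = 0 :=
  fun _ψ _κ hψ hκ hle heq => helmholtzLiouville_of_nonpos hψ hκ heq hle

end Summit.NavierStokesRegularity.NavierStokesRegularity.Theorems.PoloidalWindowDoorLrcModEntireTwistingTHT1HelmholtzOneSigned
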